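import Literature.Analysis.Matrix.FiniteRangeDecomposition
import Literature.Analysis.Fourier.FejerDyadicDecompositionPower
import Mathlib.Analysis.Matrix.Order
import Mathlib.Analysis.Matrix.HermitianFunctionalCalculus
import Mathlib.Analysis.CStarAlgebra.ContinuousFunctionalCalculus.Instances
import HarnessLib

/-!
# Finite-range decomposition with smoother pieces: the power-`m` dyadic Fejér decomposition at
# the matrix level

`Literature/Analysis/Matrix/FiniteRangeDecomposition.lean` decomposes `A⁻¹` (any symmetric
`0 ≤ A ≤ 4`) into positive semidefinite finite-range pieces `C_N = ¼P_{2^N−1}(B)²`, `B = 1 − A/2`,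
whose symbols `¼F_{2^N−1}(x)²` decay only like `x⁻⁴` off their momentum shell; in three dimensions
this makes already the FIRST lattice gradient of `C_N` logarithmically lossy.  The power-`m`
telescoping of `Literature/Analysis/Fourier/FejerDyadicDecompositionPower.lean`
(`fejerPoly_dyadic_identity_pow`) repairs this at the only price of a longer (still finite) range:
with `ρ_N := P_{2^N−1}/2^N = Π_{i<N} c_i` and `c_i := (1 + T_{2^i})/2` (`c_0 = (1+X)/2`,
`c_i = T_{2^{i−1}}²` for `i ≥ 1`), evaluated at `B`,

  `C^{(m)}_N := (4^N/4) · ρ_N(B)^{m+1} · Σ_{i<m} c_N(B)^i`,   `R^{(m)}_J := ρ_J(B)^m`,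

satisfy for EVERY square matrix `A` and all `m, J`

  `A · Σ_{N<J} C^{(m)}_N + R^{(m)}_J = 1`                       (`frdPow_identity`),

and for symmetric `A` with `A ≤ 4` (Loewner) every `C^{(m)}_N` and `R^{(m)}_J` is positive
semidefinite (products of commuting positive semidefinite polynomials in `B`:
`posSemidef_frdPiecePow`, `posSemidef_frdRemainderPow`), commutes with the commutant of `A`
(`commute_frdPiecePow`) and has finite range `≤ 2m·2^N·range(A)` (`hasFiniteRange_frdPiecePow`).
For `m = 1` the pieces are the old ones (`frdPiecePow_one`).  On an eigenvector `A v = 4sin²(πx) v`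
the symbols are `¼W^{(m)}_N(x)` and `ρ_J(x)^m` (`frdPiecePow_mulVec_of_eigen`,
`frdRemainderPow_mulVec_of_eigen`), `W^{(m)}_N` the power-`m` Fejér piece, which decays like
`x^{−2(m+1)}` — so `C^{(m)}_N` has `2m − 2` clean lattice derivatives in `d = 3`
(`…PowGradient.lean`).  The construction is [folklore]-grade algebra in the spirit of
[cite: Bauerschmidt2013, Thm. 1.2 (finite-range pieces with bounds on all derivatives)] and
[cite: BrydgesGuadagniMitter2004, Thm. 1.1].
-/

noncomputable section

open Finset Polynomial
open Literature.Analysis.Fourier.TrigApprox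

namespace Literature.Analysis.Matrix

/-! ## Products of commuting positive semidefinite real matrices -/

section Calculus

variable {V : Type*} [Fintype V] [DecidableEq V]

open scoped MatrixOrder in
/-- The product of two COMMUTING positive semidefinite real matrices is positive semidefinite
(via the continuous functional calculus on the star-ordered ring of matrices). [folklore] -/
theorem posSemidef_mul_of_commute {P Q : _root_.Matrix V V ℝ} (hP : P.PosSemidef) (hQ : Q.PosSemidef)
    (h : Commute P Q) : (P * Q).PosSemidef := by
  have hP' : (0 : _root_.Matrix V V ℝ) ≤ P := Matrix.nonneg_iff_posSemidef.mpr hP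
  have hQ' : (0 : _root_.Matrix V V ℝ) ≤ Q := Matrix.nonneg_iff_posSemidef.mpr hQ
  exact Matrix.nonneg_iff_posSemidef.mp (Commute.mul_nonneg hP' hQ' h)

/-- A product of positive semidefinite POLYNOMIALS IN ONE MATRIX `B` is positive semidefinite:
`(Π_k p_k)(B) ⪰ 0` if every `p_k(B) ⪰ 0`. [folklore] -/
theorem posSemidef_aeval_prod (B : _root_.Matrix V V ℝ) {ι : Type*} (s : Finset ι) (p : ι → ℝ[X])
    (h : ∀ k ∈ s, (Polynomial.aeval B (p k)).PosSemidef) :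
    (Polynomial.aeval B (∏ k ∈ s, p k)).PosSemidef := by
  classical
  induction s using Finset.induction_on with
  | empty => simpa using Matrix.PosSemidef.one
  | insert a s ha ih =>
    rw [Finset.prod_insert ha, map_mul]
    exact posSemidef_mul_of_commute (h a (Finset.mem_insert_self a s))
      (ih fun k hk => h k (Finset.mem_insert_of_mem hk)) (commute_aeval_aeval B _ _)

end Calculus

/-! ## The power-`m` pieces -/

section FRDPow

variable {V : Type*} [Fintype V] [DecidableEq V] (A : _root_.Matrix V V ℝ) {U : _root_.Matrix V V ℝ}

/-- The ratio polynomial `ρ_N := P_{2^N−1}/2^N` (`ρ_N(cos 2πx) = F_{2^N−1}(x)/2^N ∈ [0,1]`). [folklore] -/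
def frdRatioPoly (N : ℕ) : ℝ[X] := Polynomial.C (1 / 2 ^ N : ℝ) * fejerPoly (2 ^ N - 1)

/-- The half-angle polynomial `c_N := (1 + T_{2^N})/2` (`c_N(cos 2πx) = cos²(π2^N x)`). [folklore] -/
def frdHalfPoly (N : ℕ) : ℝ[X] := Polynomial.C (1 / 2 : ℝ) * (1 + Polynomial.Chebyshev.T ℝ (2 ^ N))

/-- **The `N`-th power-`m` finite-range piece** `C^{(m)}_N := (4^N/4)·ρ_N(B)^{m+1}·Σ_{i<m} c_N(B)^i`,
`B = 1 − A/2`. [cite: Bauerschmidt2013, Thm. 1.2 (form: positive finite-range pieces)] -/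
def frdPiecePow (m N : ℕ) : _root_.Matrix V V ℝ :=
  ((4 : ℝ) ^ N / 4) • ((Polynomial.aeval (frdCos A) (frdRatioPoly N)) ^ (m + 1)
    * ∑ i ∈ Finset.range m, (Polynomial.aeval (frdCos A) (frdHalfPoly N)) ^ i)

/-- **The power-`m` remainder after `J` scales** `R^{(m)}_J := ρ_J(B)^m`. [cite: Bauerschmidt2013, Thm. 1.2 (form)] -/
def frdRemainderPow (m J : ℕ) : _root_.Matrix V V ℝ :=
  (Polynomial.aeval (frdCos A) (frdRatioPoly J)) ^ m

/-! ### The polynomial identities behind the pieces -/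

omit [Fintype V] [DecidableEq V] in
/-- The power-`m` telescoping identity in the vocabulary of `frdRatioPoly`/`frdHalfPoly`:
`(1−X)/2 · Σ_{N<J} 4^N ρ_N^{m+1} Σ_{i<m} c_N^i + ρ_J^m = 1`. [folklore] -/
theorem frdPoly_identity (m J : ℕ) :
    Polynomial.C (1 / 2 : ℝ) * (1 - X) * ∑ N ∈ Finset.range J,
        Polynomial.C ((4 : ℝ) ^ N) * frdRatioPoly N ^ (m + 1) * ∑ i ∈ Finset.range m, frdHalfPoly N ^ i
      + frdRatioPoly J ^ m = 1 :=
  fejerPoly_dyadic_identity_pow m J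

omit [Fintype V] [DecidableEq V] in
/-- Viète: `ρ_N = Π_{i<N} c_i`. [folklore] -/
theorem frdRatioPoly_eq_prod (N : ℕ) : frdRatioPoly N = ∏ i ∈ Finset.range N, frdHalfPoly i :=
  fejerPoly_two_pow_eq_prod N

omit [Fintype V] [DecidableEq V] in
/-- `c_0 = (1 + X)/2`. [folklore] -/
theorem frdHalfPoly_zero : frdHalfPoly 0 = Polynomial.C (1 / 2 : ℝ) * (1 + X) := by
  simp [frdHalfPoly]

omit [Fintype V] [DecidableEq V] in
/-- `c_{N+1} = T_{2^N}²` (half-angle formula `1 + T_{2k} = 2T_k²`). [folklore] -/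
theorem frdHalfPoly_succ (N : ℕ) : frdHalfPoly (N + 1) = Polynomial.Chebyshev.T ℝ (2 ^ N) ^ 2 := by
  unfold frdHalfPoly
  rw [show ((2 : ℤ) ^ (N + 1)) = 2 * 2 ^ N by ring, one_add_T_two_mul, ← mul_assoc, ← Polynomial.C_ofNat,
    ← Polynomial.C_mul]
  norm_num

omit [Fintype V] [DecidableEq V] in
/-- `deg ρ_N ≤ 2^N − 1`. [folklore] -/
theorem natDegree_frdRatioPoly_le (N : ℕ) : (frdRatioPoly N).natDegree ≤ 2 ^ N - 1 :=
  (natDegree_C_mul_le _ _).trans (natDegree_fejerPoly_le _)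

omit [Fintype V] [DecidableEq V] in
/-- `deg c_N ≤ 2^N`. [folklore] -/
theorem natDegree_frdHalfPoly_le (N : ℕ) : (frdHalfPoly N).natDegree ≤ 2 ^ N := by
  unfold frdHalfPoly
  refine (natDegree_C_mul_le _ _).trans ((natDegree_add_le _ _).trans (max_le (by simp) ?_))
  rw [Polynomial.Chebyshev.natDegree_T]
  simp

/-! ### The decomposition identity -/

omit [Fintype V] in
/-- `(1 − B)/2 = A/4`. [folklore] -/
theorem half_smul_one_sub_frdCos : (1 / 2 : ℝ) • (1 - frdCos A) = (1 / 4 : ℝ) • A := by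
  rw [one_sub_frdCos, smul_smul]; norm_num

/-- **The exact power-`m` decomposition identity**: `A · Σ_{N<J} C^{(m)}_N + R^{(m)}_J = 1` for EVERY
square matrix `A` and all `m, J`. [cite: BrydgesGuadagniMitter2004, Thm. 1.1 (form)] -/
theorem frdPow_identity (m J : ℕ) :
    A * ∑ N ∈ Finset.range J, frdPiecePow A m N + frdRemainderPow A m J = 1 := by
  have h := congrArg (Polynomial.aeval (frdCos A)) (frdPoly_identity m J)
  simp only [map_add (Polynomial.aeval (frdCos A)), map_mul (Polynomial.aeval (frdCos A)),
    map_sum (Polynomial.aeval (frdCos A)), map_pow (Polynomial.aeval (frdCos A)), Polynomial.aeval_C,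
    Algebra.algebraMap_eq_smul_one, smul_one_mul] at h
  simp only [map_sub, map_one, Polynomial.aeval_X] at h
  rw [half_smul_one_sub_frdCos, smul_mul_assoc, Finset.mul_sum, Finset.smul_sum] at h
  rw [← h]
  unfold frdPiecePow frdRemainderPow
  congr 1
  rw [Finset.mul_sum]
  refine Finset.sum_congr rfl fun N _ => ?_
  rw [smul_mul_assoc, mul_smul_comm, mul_smul_comm, smul_smul]
  congr 1
  ring

/-- For an invertible `A`: `A⁻¹ = Σ_{N<J} C^{(m)}_N + A⁻¹ R^{(m)}_J`. [cite: BrydgesGuadagniMitter2004, Thm. 1.1 (form)] -/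
theorem frdPow_inverse (m J : ℕ) (hA : IsUnit A.det) :
    A⁻¹ = ∑ N ∈ Finset.range J, frdPiecePow A m N + A⁻¹ * frdRemainderPow A m J := by
  have h2 := congrArg (fun M => A⁻¹ * M) (frdPow_identity A m J)
  simp only [mul_add, ← mul_assoc, Matrix.nonsing_inv_mul _ hA, one_mul, mul_one] at h2
  exact h2.symm

/-- For `m = 1` the pieces are those of `FiniteRangeDecomposition.lean`: `C^{(1)}_N = ¼P_{2^N−1}(B)²`.
[folklore] -/
theorem frdPiecePow_one (N : ℕ) : frdPiecePow A 1 N = frdPiece A N := by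
  unfold frdPiecePow frdPiece frdRatioPoly
  simp only [Finset.range_one, Finset.sum_singleton, pow_zero, mul_one, map_mul, Polynomial.aeval_C,
    Algebra.algebraMap_eq_smul_one, smul_one_mul, smul_pow, smul_smul]
  congr 1
  rw [show (1 : ℕ) + 1 = 2 by rfl, one_div_pow, ← pow_mul,
    show (2 : ℝ) ^ (N * 2) = 4 ^ N by rw [mul_comm, pow_mul]; norm_num]
  field_simp

/-- `R^{(1)}_J = R_J`. [folklore] -/
theorem frdRemainderPow_one (J : ℕ) : frdRemainderPow A 1 J = frdRemainder A J := by
  unfold frdRemainderPow frdRemainder frdRatioPoly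
  simp only [pow_one, map_mul, Polynomial.aeval_C, Algebra.algebraMap_eq_smul_one, smul_one_mul]

/-- `R^{(m)}_0 = 1`. [folklore] -/
theorem frdRemainderPow_zero (m : ℕ) : frdRemainderPow A m 0 = 1 := by
  unfold frdRemainderPow frdRatioPoly
  simp

/-! ### Positivity -/

variable {A}

/-- `c_N(B)` is positive semidefinite when `A` is symmetric with `A ≤ 4`: `c_0(B) = ¼(4 − A)` and
`c_{N+1}(B) = T_{2^N}(B)²`. [folklore] -/
theorem posSemidef_aeval_frdHalfPoly (hA : A.IsHermitian)
    (h4 : ((4 : ℝ) • (1 : _root_.Matrix V V ℝ) - A).PosSemidef) (N : ℕ) :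
    (Polynomial.aeval (frdCos A) (frdHalfPoly N)).PosSemidef := by
  rcases N with _ | N
  · rw [frdHalfPoly_zero]
    simp only [map_mul, map_add, map_one, Polynomial.aeval_C, Polynomial.aeval_X,
      Algebra.algebraMap_eq_smul_one]
    rw [smul_one_mul, smul_add, half_one_add_half_frdCos]
    exact h4.smul (by norm_num)
  · rw [frdHalfPoly_succ, map_pow]
    have hM := isHermitian_aeval (isHermitian_frdCos hA) (Polynomial.Chebyshev.T ℝ (2 ^ N))
    rw [sq, ← hM.eq]
    nth_rewrite 2 [hM.eq]
    exact Matrix.posSemidef_conjTranspose_mul_self _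

/-- `ρ_N(B) = Π_{i<N} c_i(B)` is positive semidefinite when `A` is symmetric with `A ≤ 4`. [folklore] -/
theorem posSemidef_aeval_frdRatioPoly (hA : A.IsHermitian)
    (h4 : ((4 : ℝ) • (1 : _root_.Matrix V V ℝ) - A).PosSemidef) (N : ℕ) :
    (Polynomial.aeval (frdCos A) (frdRatioPoly N)).PosSemidef := by
  rw [frdRatioPoly_eq_prod]
  exact posSemidef_aeval_prod _ _ _ fun i _ => posSemidef_aeval_frdHalfPoly hA h4 i

/-- **Each power-`m` piece is positive semidefinite** for symmetric `A ≤ 4`.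
[cite: Bauerschmidt2013, Thm. 1.2 (i)] -/
theorem posSemidef_frdPiecePow (hA : A.IsHermitian)
    (h4 : ((4 : ℝ) • (1 : _root_.Matrix V V ℝ) - A).PosSemidef) (m N : ℕ) :
    (frdPiecePow A m N).PosSemidef := by
  unfold frdPiecePow
  refine (posSemidef_mul_of_commute ((posSemidef_aeval_frdRatioPoly hA h4 N).pow _)
    (posSemidef_sum _ fun i _ => (posSemidef_aeval_frdHalfPoly hA h4 N).pow _) ?_).smul
    (by positivity)
  exact Commute.sum_right _ _ _ fun i _ =>
    ((commute_aeval_aeval (frdCos A) _ _).pow_left _).pow_right _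

/-- The partial sums `Σ_{N<J} C^{(m)}_N` are positive semidefinite. [cite: Bauerschmidt2013, Thm. 1.2 (i)] -/
theorem posSemidef_sum_frdPiecePow (hA : A.IsHermitian)
    (h4 : ((4 : ℝ) • (1 : _root_.Matrix V V ℝ) - A).PosSemidef) (m J : ℕ) :
    (∑ N ∈ Finset.range J, frdPiecePow A m N).PosSemidef :=
  posSemidef_sum _ fun N _ => posSemidef_frdPiecePow hA h4 m N

/-- **The power-`m` remainder is positive semidefinite** for symmetric `A ≤ 4`.
[cite: Bauerschmidt2013, Thm. 1.2 (i)] -/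
theorem posSemidef_frdRemainderPow (hA : A.IsHermitian)
    (h4 : ((4 : ℝ) • (1 : _root_.Matrix V V ℝ) - A).PosSemidef) (m J : ℕ) :
    (frdRemainderPow A m J).PosSemidef :=
  (posSemidef_aeval_frdRatioPoly hA h4 J).pow m

/-- The pieces are symmetric. [folklore] -/
theorem isHermitian_frdPiecePow (hA : A.IsHermitian)
    (h4 : ((4 : ℝ) • (1 : _root_.Matrix V V ℝ) - A).PosSemidef) (m N : ℕ) :
    (frdPiecePow A m N).IsHermitian :=
  (posSemidef_frdPiecePow hA h4 m N).1

/-! ### Symmetries are inherited -/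

/-- **Whatever commutes with `A` commutes with every piece `C^{(m)}_N`.** [cite: Bauerschmidt2013, Thm. 1.2 (iii)] -/
theorem commute_frdPiecePow (h : Commute U A) (m N : ℕ) : Commute U (frdPiecePow A m N) := by
  unfold frdPiecePow
  refine (Commute.mul_right ((commute_aeval_of_commute (commute_frdCos h) _).pow_right _)
    (Commute.sum_right _ _ _ fun i _ => ?_)).smul_right _
  exact (commute_aeval_of_commute (commute_frdCos h) _).pow_right _

/-- Whatever commutes with `A` commutes with `R^{(m)}_J`. [cite: Bauerschmidt2013, Thm. 1.2 (iii)] -/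
theorem commute_frdRemainderPow (h : Commute U A) (m J : ℕ) : Commute U (frdRemainderPow A m J) :=
  (commute_aeval_of_commute (commute_frdCos h) _).pow_right _

/-- The pieces commute with `A`. [folklore] -/
theorem commute_frdPiecePow_self (m N : ℕ) : Commute A (frdPiecePow A m N) :=
  commute_frdPiecePow (Commute.refl A) m N

/-! ### Finite range -/

variable {d : V → V → ℕ} {R : ℕ}

/-- `ρ_N(B)` has range `≤ (2^N − 1)·R`. [folklore] -/
theorem hasFiniteRange_aeval_frdRatioPoly (htri : ∀ i j k, d i k ≤ d i j + d j k) (hd : ∀ i, d i i = 0)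
    (hA : HasFiniteRange d R A) (N : ℕ) :
    HasFiniteRange d ((2 ^ N - 1) * R) (Polynomial.aeval (frdCos A) (frdRatioPoly N)) :=
  ((hasFiniteRange_frdCos hd hA).aeval htri hd _).mono (Nat.mul_le_mul_right _ (natDegree_frdRatioPoly_le _))

/-- `c_N(B)` has range `≤ 2^N·R`. [folklore] -/
theorem hasFiniteRange_aeval_frdHalfPoly (htri : ∀ i j k, d i k ≤ d i j + d j k) (hd : ∀ i, d i i = 0)
    (hA : HasFiniteRange d R A) (N : ℕ) :
    HasFiniteRange d (2 ^ N * R) (Polynomial.aeval (frdCos A) (frdHalfPoly N)) :=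
  ((hasFiniteRange_frdCos hd hA).aeval htri hd _).mono (Nat.mul_le_mul_right _ (natDegree_frdHalfPoly_le _))

/-- **`C^{(m)}_N` has range `≤ 2m·2^N·R`.** [cite: BrydgesGuadagniMitter2004, Thm. 1.1 (finite range)] -/
theorem hasFiniteRange_frdPiecePow (htri : ∀ i j k, d i k ≤ d i j + d j k) (hd : ∀ i, d i i = 0)
    (hA : HasFiniteRange d R A) (m N : ℕ) :
    HasFiniteRange d (2 * m * 2 ^ N * R) (frdPiecePow A m N) := by
  unfold frdPiecePow
  rcases m with _ | m
  · simp only [Finset.range_zero, Finset.sum_empty, mul_zero, smul_zero]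
    exact HasFiniteRange.zero
  have hρ := (hasFiniteRange_aeval_frdRatioPoly htri hd hA N).pow htri hd (m + 1 + 1)
  have hc : HasFiniteRange d (m * (2 ^ N * R))
      (∑ i ∈ Finset.range (m + 1), (Polynomial.aeval (frdCos A) (frdHalfPoly N)) ^ i) := by
    refine HasFiniteRange.sum _ fun i hi => ?_
    refine ((hasFiniteRange_aeval_frdHalfPoly htri hd hA N).pow htri hd i).mono ?_
    have : i ≤ m := by have := Finset.mem_range.mp hi; omega
    exact Nat.mul_le_mul_right _ this
  refine ((hρ.mul htri hc).smul _).mono ?_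
  -- `(m+2)(2^N − 1)R + m·2^N R ≤ 2(m+1) 2^N R`
  have h2 : (m + 1 + 1) * ((2 ^ N - 1) * R) ≤ (m + 1 + 1) * (2 ^ N * R) :=
    Nat.mul_le_mul_left _ (Nat.mul_le_mul_right _ (Nat.sub_le _ _))
  have h3 : (m + 1 + 1) * (2 ^ N * R) + m * (2 ^ N * R) = 2 * (m + 1) * 2 ^ N * R := by ring
  omega

/-- **`R^{(m)}_J` has range `≤ m(2^J − 1)·R`.** [cite: BrydgesGuadagniMitter2004, Thm. 1.1 (finite range)] -/
theorem hasFiniteRange_frdRemainderPow (htri : ∀ i j k, d i k ≤ d i j + d j k) (hd : ∀ i, d i i = 0)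
    (hA : HasFiniteRange d R A) (m J : ℕ) :
    HasFiniteRange d (m * ((2 ^ J - 1) * R)) (frdRemainderPow A m J) :=
  (hasFiniteRange_aeval_frdRatioPoly htri hd hA J).pow htri hd m

/-! ### The symbol on eigenvectors -/

/-- On an eigenvector `A v = 4 sin²(πx) v`: `ρ_N(B) v = (F_{2^N−1}(x)/2^N) v`. [folklore] -/
theorem aeval_frdRatioPoly_mulVec_of_eigen {v : V → ℝ} {x : ℝ}
    (hv : A.mulVec v = (4 * Real.sin (Real.pi * x) ^ 2) • v) (N : ℕ) :
    (Polynomial.aeval (frdCos A) (frdRatioPoly N)).mulVec v = (fejer (2 ^ N - 1) x / 2 ^ N) • v := by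
  have h1 := aeval_mulVec_of_eigen (frdCos_mulVec_of_eigen hv) (frdRatioPoly N)
  rw [h1]
  congr 1
  unfold frdRatioPoly
  rw [Polynomial.eval_mul, Polynomial.eval_C, fejerPoly_eval_cos]
  ring

/-- On an eigenvector `A v = 4 sin²(πx) v`: `c_N(B) v = cos²(π2^N x) v`. [folklore] -/
theorem aeval_frdHalfPoly_mulVec_of_eigen {v : V → ℝ} {x : ℝ}
    (hv : A.mulVec v = (4 * Real.sin (Real.pi * x) ^ 2) • v) (N : ℕ) :
    (Polynomial.aeval (frdCos A) (frdHalfPoly N)).mulVec v = (Real.cos (Real.pi * (2 ^ N * x)) ^ 2) • v := by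
  have h1 := aeval_mulVec_of_eigen (frdCos_mulVec_of_eigen hv) (frdHalfPoly N)
  rw [h1]
  congr 1
  unfold frdHalfPoly
  rw [Polynomial.eval_mul, Polynomial.eval_C, Polynomial.eval_add, Polynomial.eval_one, eval_T_two_pow_cos]
  ring

/-- Powers act on an eigenvector by powers of the eigenvalue. [folklore] -/
private theorem pow_mulVec_of_eigen {M : _root_.Matrix V V ℝ} {v : V → ℝ} {μ : ℝ}
    (hv : M.mulVec v = μ • v) (k : ℕ) : (M ^ k).mulVec v = μ ^ k • v := by
  induction k with
  | zero => simp
  | succ k ih => rw [pow_succ, ← Matrix.mulVec_mulVec, hv, Matrix.mulVec_smul, ih, smul_smul, pow_succ, mul_comm]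

/-- **Symbol of the power-`m` pieces**: on an eigenvector `A v = 4 sin²(πx) v`,
`C^{(m)}_N v = ¼ W^{(m)}_N(x) v` with `W^{(m)}_N = 4^N ρ_N^{m+1} Σ_{i<m} c_N^i` the power-`m` Fejér
piece. [cite: Bauerschmidt2013, Thm. 1.2 (ii) (form)] -/
theorem frdPiecePow_mulVec_of_eigen {v : V → ℝ} {x : ℝ}
    (hv : A.mulVec v = (4 * Real.sin (Real.pi * x) ^ 2) • v) (m N : ℕ) :
    (frdPiecePow A m N).mulVec v
      = (1 / 4 * (4 ^ N * (fejer (2 ^ N - 1) x / 2 ^ N) ^ (m + 1)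
          * ∑ i ∈ Finset.range m, (Real.cos (Real.pi * (2 ^ N * x)) ^ 2) ^ i)) • v := by
  unfold frdPiecePow
  have hρ := pow_mulVec_of_eigen (aeval_frdRatioPoly_mulVec_of_eigen hv N) (m + 1)
  have hc : (∑ i ∈ Finset.range m, (Polynomial.aeval (frdCos A) (frdHalfPoly N)) ^ i).mulVec v
      = (∑ i ∈ Finset.range m, (Real.cos (Real.pi * (2 ^ N * x)) ^ 2) ^ i) • v := by
    rw [Matrix.sum_mulVec, Finset.sum_smul]
    exact Finset.sum_congr rfl fun i _ => pow_mulVec_of_eigen (aeval_frdHalfPoly_mulVec_of_eigen hv N) i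
  rw [Matrix.smul_mulVec, ← Matrix.mulVec_mulVec, hc, Matrix.mulVec_smul, hρ, smul_smul, smul_smul]
  congr 1
  ring

/-- **Symbol of the power-`m` remainder**: on an eigenvector `A v = 4 sin²(πx) v`,
`R^{(m)}_J v = (F_{2^J−1}(x)/2^J)^m v`. [cite: Bauerschmidt2013, Thm. 1.2 (ii) (form)] -/
theorem frdRemainderPow_mulVec_of_eigen {v : V → ℝ} {x : ℝ}
    (hv : A.mulVec v = (4 * Real.sin (Real.pi * x) ^ 2) • v) (m J : ℕ) :
    (frdRemainderPow A m J).mulVec v = ((fejer (2 ^ J - 1) x / 2 ^ J) ^ m) • v :=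
  pow_mulVec_of_eigen (aeval_frdRatioPoly_mulVec_of_eigen hv J) m

end FRDPow

end Literature.Analysis.Matrix

end
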